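/-
Copyright (c) 2026. All rights reserved.
Released under Apache 2.0 license as described in the file LICENSE.
-/
import Summits.BirchSwinnertonDyer.BirchSwinnertonDyer.Theorems.ByReductionTypeAtTwoRankOneSigmaHeightLogFreeLawModSixtyFour
import HarnessLib

/-!
# The level-one `η`-height law modulo `128` (route `ByReductionTypeAtTwo`, crux `RankOneAtTwoBigImageOddLocal`, §54 of the analytic lens memo)

One binary digit beyond `ByReductionTypeAtTwoRankOneSigmaHeightLogFreeLawModSixtyFour`: for a `ℤ`-integral Weierstrass equation
`V/ℚ` with `a₁ = 0`, the formally even `Σ₀` (`c = 0`, the `η`-normalisation) and a height datum `D` computed by the `σ`-formula on the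
good locus, every rational point `Q = (x, y)` of `2`-adic level one (`‖x‖₂ = 4`) with non-singular reduction at every prime satisfies,
with `a = num x` and `d = den x` (so `a ≡ 1 (mod 4)`, `d = 4m`, `m` odd),

  `⟨Q,Q⟩_D ≡ (a − 1) − (a − 1)²/2 − 16a₄(a − 1) + 32a₄ − a₄d²/2 − 8a₃²d − 64a₂a₃ (mod 128)`.

Here the DENOMINATOR enters for the first time (`a₄d²/2 = 8a₄m²`, `8a₃²d = 32a₃²m`), as do `a₂` (through `64a₂a₃`) and the square
of `a₃`; modulo `64` the law collapses to the denominator-free `(a−1) − (a−1)²/2 + 24a₄ − 32a₃`.  Proof: the effective Tate formula with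
two doublings (`‖⟨Q,Q⟩ − 16⁻¹ log₂ num x(4Q)‖₂ ≤ 2⁻⁷`, `…TateRate`), Néron's duplication numerator/denominator twice, and the integer
congruence `num x(4Q) ≡ 1 + 16·LAW (mod 2¹¹)` (`neronNumerator_iterate_two_congr_two_pow_eleven` below), which refines the congruence
modulo `2¹⁰` of `…NeronIterate`; `‖num x(4Q) − 1‖₂ ≤ 2⁻⁶` makes `log₂` linear to the required precision (`…LogFreeLaw`).  Census:
`v₂(⟨Q,Q⟩_η − LAW) ≥ 7` on 840/840 level-one rows of the cell's table, `= 7` on 428 of them (MEMO-an §54 (54.12)), so the law is sharp.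
Printed context: [cite: MazurSteinTate2006, §1] (`σ`-heights, `p` odd in print), [cite: SilvermanAEC2009, III.2.3(d), VII.2, VIII.9].

## Main statements

* `neronNumerator_iterate_two_congr_two_pow_eleven`: `num x(4Q)` modulo `2¹¹` (pure integer arithmetic).
* `norm_pairing_sub_law_le_inv_oneTwentyEight`: the displayed bound `≤ 128⁻¹`.
* `exists_heightData_levelOne_law_mod_oneTwentyEight_two`: `Sq`-free packaging over an elliptic `ℤ`-integral `V` with `a₁ = 0`.
-/

open scoped Classical

open WeierstrassCurve PowerSeries Literature Literature.NumberTheory.EllipticCurves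

namespace Summit.BirchSwinnertonDyer.BirchSwinnertonDyer.Theorems

namespace NaiveSigmaLogAtTwo

/-- **Two Néron doublings modulo `2¹¹`.**  For integers `a₂, a₃, a₄, a₆` (`a₁ = 0`), `a = 1 + 4u` and `D = 4m` with `m` odd, put
`a′ = N(a, D)`, `D′ = M(a, D)`, `a″ = N(a′, D′)`; then
`a″ ≡ 1 + 64u − 128u² + 384a₄ − 1024a₄u − 128a₄(m² − 1) − 512a₃²m − 1024a₂a₃ (mod 2048)`.
[cite: SilvermanAEC2009, III.2.3(d), VII.2] -/
theorem neronNumerator_iterate_two_congr_two_pow_eleven (A₂ A₃ A₄ A₆ a D a' D' a'' u m : ℤ) (hau : a = 4 * u + 1)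
    (hm : Odd m) (hDm : D = 4 * m)
    (ha' : a' = a ^ 4 - 2 * A₄ * a ^ 2 * D ^ 2 - 2 * (A₃ ^ 2 + 4 * A₆) * a * D ^ 3
      - (4 * A₂ * A₆ + A₂ * A₃ ^ 2 - A₄ ^ 2) * D ^ 4)
    (hD' : D' = D * (4 * a ^ 3 + 4 * A₂ * a ^ 2 * D + 2 * (2 * A₄) * a * D ^ 2 + (A₃ ^ 2 + 4 * A₆) * D ^ 3))
    (ha'' : a'' = a' ^ 4 - 2 * A₄ * a' ^ 2 * D' ^ 2 - 2 * (A₃ ^ 2 + 4 * A₆) * a' * D' ^ 3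
      - (4 * A₂ * A₆ + A₂ * A₃ ^ 2 - A₄ ^ 2) * D' ^ 4) :
    (2048 : ℤ) ∣ a'' - 1 - (64 * u - 128 * u ^ 2 + 384 * A₄ - 1024 * A₄ * u - 128 * A₄ * (m ^ 2 - 1)
      - 512 * A₃ ^ 2 * m - 1024 * A₂ * A₃) := by
  -- the auxiliary quantities of the first doubling
  obtain ⟨U, hU⟩ : ∃ U : ℤ, U = -A₄ * a ^ 2 * m ^ 2 - 4 * (A₃ ^ 2 + 4 * A₆) * a * m ^ 3
      - 8 * (4 * A₂ * A₆ + A₂ * A₃ ^ 2 - A₄ ^ 2) * m ^ 4 := ⟨_, rfl⟩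
  obtain ⟨M, hM⟩ : ∃ M : ℤ, M = m * (a ^ 3 + 4 * A₂ * a ^ 2 * m + 16 * A₄ * a * m ^ 2 + 16 * (A₃ ^ 2 + 4 * A₆) * m ^ 3) :=
    ⟨_, rfl⟩
  have e1 : a' = a ^ 4 + 32 * U := by rw [ha', hDm, hU]; exact neronNumerator_eq_pow_four_add A₂ A₃ A₄ A₆ a m
  have e2 : D' = 16 * M := by rw [hD', hDm, hM]; exact neronDenominator_eq_sixteen_mul A₂ A₃ A₄ A₆ a m
  -- second doubling modulo `2048`
  have e3 : a'' = a' ^ 4 - 512 * A₄ * (a' * M) ^ 2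
      + 2048 * (4 * (-(A₃ ^ 2 + 4 * A₆) * a' * M ^ 3 - 8 * (4 * A₂ * A₆ + A₂ * A₃ ^ 2 - A₄ ^ 2) * M ^ 4)) := by
    rw [ha'', e2]; ring
  -- parities
  have hao : Odd a := ⟨2 * u, by linarith⟩
  have ha'o : Odd a' := by
    have h2 : a' = 2 * (16 * U) + a ^ 4 := by rw [e1]; ring
    rw [h2]; exact (even_two_mul _).add_odd hao.pow
  have hMo : Odd M := by
    have hM2 : M = 2 * (m * (2 * A₂ * a ^ 2 * m + 8 * A₄ * a * m ^ 2 + 8 * (A₃ ^ 2 + 4 * A₆) * m ^ 3)) + m * a ^ 3 := by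
      rw [hM]; ring
    rw [hM2]; exact (even_two_mul _).add_odd (hm.mul hao.pow)
  -- the six pieces
  have p1 : (2048 : ℤ) ∣ a' ^ 4 - a ^ 16 - 128 * a ^ 12 * U :=
    ⟨3 * a ^ 8 * U ^ 2 + 64 * a ^ 4 * U ^ 3 + 512 * U ^ 4, by rw [e1]; ring⟩
  have p2 : (2048 : ℤ) ∣ 512 * A₄ * ((a' * M) ^ 2 - 1) := by
    obtain ⟨c, hc⟩ := eight_dvd_sq_sub_one_of_odd (ha'o.mul hMo)
    exact ⟨2 * A₄ * c, by rw [hc]; ring⟩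
  have p4 : (2048 : ℤ) ∣ 128 * U * (a ^ 12 - 1) := by
    obtain ⟨c, hc⟩ := eight_dvd_sq_sub_one_of_odd hao
    have ha2 : a ^ 2 = 8 * c + 1 := by linarith
    exact ⟨U * (3 * c + 60 * c ^ 2 + 640 * c ^ 3 + 3840 * c ^ 4 + 12288 * c ^ 5 + 16384 * c ^ 6), by
      rw [show a ^ 12 = (a ^ 2) ^ 6 by ring, ha2]; ring⟩
  have p5 : (2048 : ℤ) ∣ a ^ 16 - 1 - (64 * u - 128 * u ^ 2) := by
    obtain ⟨i, hi⟩ := Int.even_mul_succ_self u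
    exact ⟨u ^ 2 + 2184 * u ^ 5 + 16016 * u ^ 6 + 91520 * u ^ 7 + 411840 * u ^ 8 + 1464320 * u ^ 9 + 4100096 * u ^ 10
      + 8945664 * u ^ 11 + 14909440 * u ^ 12 + 18350080 * u ^ 13 + 15728640 * u ^ 14 + 8388608 * u ^ 15
      + 2097152 * u ^ 16 + 210 * u ^ 4 + 35 * u ^ 2 * i, by
        rw [hau]; linear_combination (35840 * u ^ 2) * hi⟩
  have p6 : (2048 : ℤ) ∣ 128 * U - 896 * A₄ + 1024 * A₄ * u + 128 * A₄ * (m ^ 2 - 1) + 512 * A₃ ^ 2 * m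
      + 1024 * A₂ * A₃ := by
    obtain ⟨μ, hμ⟩ := eight_dvd_sq_sub_one_of_odd hm
    obtain ⟨i₃, hi3⟩ := Int.even_mul_succ_self (A₃ - 1)
    obtain ⟨i₄, hi4⟩ := Int.even_mul_succ_self (A₄ - 1)
    subst hau
    exact ⟨-A₄ * (u ^ 2 + 4 * μ * u * (1 + 2 * u)) - A₃ ^ 2 * m * (2 * μ + u * m ^ 2) - A₆ * (4 * u + 1) * m ^ 3
        - 2 * A₂ * A₆ * m ^ 4 - A₂ * (4 * A₃ ^ 2 * μ * (m ^ 2 + 1) + i₃) + 4 * A₄ ^ 2 * μ * (m ^ 2 + 1) + i₄, by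
      linear_combination 128 * hU
        + (256 * (-4 * A₄ * u * (1 + 2 * u) - 2 * A₃ ^ 2 * m - 4 * A₂ * A₃ ^ 2 * (m ^ 2 + 1) + 4 * A₄ ^ 2 * (m ^ 2 + 1))) * hμ
        + (-1024 * A₂) * hi3 + 1024 * hi4⟩
  -- assemble
  have key : a'' - 1 - (64 * u - 128 * u ^ 2 + 384 * A₄ - 1024 * A₄ * u - 128 * A₄ * (m ^ 2 - 1)
      - 512 * A₃ ^ 2 * m - 1024 * A₂ * A₃) =
      (a' ^ 4 - a ^ 16 - 128 * a ^ 12 * U) - 512 * A₄ * ((a' * M) ^ 2 - 1)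
        + 2048 * (4 * (-(A₃ ^ 2 + 4 * A₆) * a' * M ^ 3 - 8 * (4 * A₂ * A₆ + A₂ * A₃ ^ 2 - A₄ ^ 2) * M ^ 4))
        + 128 * U * (a ^ 12 - 1) + (a ^ 16 - 1 - (64 * u - 128 * u ^ 2))
        + (128 * U - 896 * A₄ + 1024 * A₄ * u + 128 * A₄ * (m ^ 2 - 1) + 512 * A₃ ^ 2 * m + 1024 * A₂ * A₃) := by
    rw [e3]; ring
  rw [key]
  exact dvd_add (dvd_add (dvd_add (dvd_add (dvd_sub p1 p2) (dvd_mul_right 2048 _)) p4) p5) p6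

/-- **The level-one `η`-height law modulo `128` (kernel)**: with `a = num x`, `d = den x`,
`‖⟨Q,Q⟩_D − ((a−1) − (a−1)²/2 − 16a₄(a−1) + 32a₄ − a₄d²/2 − 8a₃²d − 64a₂a₃)‖₂ ≤ 128⁻¹` for a level-one point `Q = (x, y)` (`‖x‖₂ = 4`)
with non-singular reduction everywhere, on a `ℤ`-integral model with `a₁ = 0`, for any height datum given by the `σ`-formula with the
formally even `Σ₀` (`c = 0`). [cite: SilvermanAEC2009, III.2.3(d), VIII.9] [cite: MazurSteinTate2006, §1] -/
theorem norm_pairing_sub_law_le_inv_oneTwentyEight (V : WeierstrassCurve ℚ) [V.IsIntegral ℤ] (ha1 : V.a₁ = 0)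
    (Sq : ℚ_[2]⟦X⟧) (h0 : constantCoeff Sq = 0) (h1 : coeff 1 Sq = 0) (h2 : coeff 2 Sq = 1) (h3 : coeff 3 Sq = 0)
    (hODE : (V.baseChange ℚ_[2]).SatisfiesSigmaSqODE Sq 0) (D : PAdicHeightData V 2)
    (hD : ∀ {x y : ℚ} (h : V.toAffine.Nonsingular x y), V.SatisfiesLocalConditions 2 (.some x y h) →
      D.pairing (.some x y h) (.some x y h) = padicLog 2 ((x.den : ℚ) : ℚ_[2]) - padicLog 2 (padicEval Sq (-(x : ℚ_[2]) / y)))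
    {x y : ℚ} (h : V.toAffine.Nonsingular x y) (hx : ‖(x : ℚ_[2])‖ = 4)
    (hns : ∀ ℓ : ℕ, ℓ.Prime → V.HasNonsingularReductionAt ℓ x y) :
    ‖D.pairing (.some x y h) (.some x y h) - (((x.num : ℚ_[2]) - 1) - ((x.num : ℚ_[2]) - 1) ^ 2 / 2
        - 16 * (V.a₄ : ℚ_[2]) * ((x.num : ℚ_[2]) - 1) + 32 * (V.a₄ : ℚ_[2]) - (V.a₄ : ℚ_[2]) * (x.den : ℚ_[2]) ^ 2 / 2
        - 8 * (V.a₃ : ℚ_[2]) ^ 2 * (x.den : ℚ_[2]) - 64 * (V.a₂ : ℚ_[2]) * (V.a₃ : ℚ_[2]))‖ ≤ 128⁻¹ := by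
  -- integer coefficients
  obtain ⟨A₂, hA2⟩ : ∃ A : ℤ, V.a₂ = A := ⟨(WeierstrassCurve.integralModel ℤ V).a₂, by
    rw [← WeierstrassCurve.integralModel_a₂_eq ℤ V]; exact eq_intCast _ _⟩
  obtain ⟨A₃, hA3⟩ : ∃ A : ℤ, V.a₃ = A := ⟨(WeierstrassCurve.integralModel ℤ V).a₃, by
    rw [← WeierstrassCurve.integralModel_a₃_eq ℤ V]; exact eq_intCast _ _⟩
  obtain ⟨A₄, hA4⟩ : ∃ A : ℤ, V.a₄ = A := ⟨(WeierstrassCurve.integralModel ℤ V).a₄, by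
    rw [← WeierstrassCurve.integralModel_a₄_eq ℤ V]; exact eq_intCast _ _⟩
  obtain ⟨A₆, hA6⟩ : ∃ A : ℤ, V.a₆ = A := ⟨(WeierstrassCurve.integralModel ℤ V).a₆, by
    rw [← WeierstrassCurve.integralModel_a₆_eq ℤ V]; exact eq_intCast _ _⟩
  have hb2 : V.b₂ = 4 * A₂ := by rw [WeierstrassCurve.b₂, ha1, hA2]; ring
  have hb4 : V.b₄ = 2 * A₄ := by rw [WeierstrassCurve.b₄, ha1, hA3, hA4]; ring
  have hb6 : V.b₆ = A₃ ^ 2 + 4 * A₆ := by rw [WeierstrassCurve.b₆, hA3, hA6]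
  have hb8 : V.b₈ = 4 * A₂ * A₆ + A₂ * A₃ ^ 2 - A₄ ^ 2 := by
    rw [WeierstrassCurve.b₈, ha1, hA2, hA3, hA4, hA6]; ring
  -- the points `2Q` and `4Q`
  have hx4 : (4 : ℝ) ≤ ‖(x : ℚ_[2])‖ := hx.ge
  obtain ⟨x₂, y₂, h₂, e₂⟩ := exists_two_pow_nsmul_eq_some V ha1 h hx4 1
  obtain ⟨x₄, y₄, h₄, e₄⟩ := exists_two_pow_nsmul_eq_some V ha1 h hx4 2
  have e₂' : (2 : ℕ) • (.some x y h : V.toAffine.Point) = .some x₂ y₂ h₂ := by simpa using e₂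
  have e₂₄ : (2 : ℕ) • (.some x₂ y₂ h₂ : V.toAffine.Point) = .some x₄ y₄ h₄ := by
    rw [← e₂', ← mul_nsmul', show (2 * 2 : ℕ) = 2 ^ 2 by norm_num]
    exact e₄
  have hloc₂ := satisfiesLocalConditions_two_pow_nsmul V ha1 h hx4 hns 1 le_rfl h₂ e₂
  dsimp only [WeierstrassCurve.SatisfiesLocalConditions] at hloc₂
  have hns₂ : ∀ ℓ : ℕ, ℓ.Prime → V.HasNonsingularReductionAt ℓ x₂ y₂ := hloc₂.2.2
  -- Néron twice, as integer identities
  obtain ⟨hN₂, hM₂⟩ := num_den_two_nsmul_eq V h h₂ hns e₂'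
  have hN₄ := num_two_nsmul_eq_neronNumerator V h₂ h₄ hns₂ e₂₄
  have ha' : x₂.num = x.num ^ 4 - 2 * A₄ * x.num ^ 2 * (x.den : ℤ) ^ 2
      - 2 * (A₃ ^ 2 + 4 * A₆) * x.num * (x.den : ℤ) ^ 3 - (4 * A₂ * A₆ + A₂ * A₃ ^ 2 - A₄ ^ 2) * (x.den : ℤ) ^ 4 := by
    apply Int.cast_injective (α := ℚ)
    rw [hN₂, hb4, hb6, hb8]; push_cast; ring
  have hD' : (x₂.den : ℤ) = (x.den : ℤ) * (4 * x.num ^ 3 + 4 * A₂ * x.num ^ 2 * (x.den : ℤ)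
      + 2 * (2 * A₄) * x.num * (x.den : ℤ) ^ 2 + (A₃ ^ 2 + 4 * A₆) * (x.den : ℤ) ^ 3) := by
    apply Int.cast_injective (α := ℚ)
    push_cast
    rw [hM₂, hb2, hb4, hb6]
  have ha'' : x₄.num = x₂.num ^ 4 - 2 * A₄ * x₂.num ^ 2 * (x₂.den : ℤ) ^ 2
      - 2 * (A₃ ^ 2 + 4 * A₆) * x₂.num * (x₂.den : ℤ) ^ 3 - (4 * A₂ * A₆ + A₂ * A₃ ^ 2 - A₄ ^ 2) * (x₂.den : ℤ) ^ 4 := by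
    apply Int.cast_injective (α := ℚ)
    rw [hN₄, hb4, hb6, hb8]; push_cast; ring
  -- the shape of a level-one point: `a = 1 + 4u`, `den x = 4m` with `m` odd
  have h4a : (4 : ℤ) ∣ x.num - 1 := by
    have hq := norm_cast_num_sub_one_le_quarter V h ha1 hx
    have := (Padic.norm_int_le_pow_iff_dvd (p := 2) (x.num - 1) 2).mp (by
      push_cast; exact hq.trans (by norm_num))
    simpa using this
  obtain ⟨u, hu⟩ := h4a
  have hau : x.num = 4 * u + 1 := by linarith
  have hndX : ‖(x.den : ℚ_[2])‖ = 4⁻¹ := by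
    rw [norm_natCast_den_eq x, hx, max_eq_right (by norm_num : (1 : ℝ) ≤ 4)]
  have hdvd : (2 : ℤ) ^ 2 ∣ (x.den : ℤ) := (Padic.norm_int_le_pow_iff_dvd (p := 2) (x.den : ℤ) 2).mp (by
    rw [Int.cast_natCast, hndX]; norm_num)
  obtain ⟨m, hδ⟩ := hdvd
  have hDm : (x.den : ℤ) = 4 * m := by linear_combination hδ
  have h2n : ‖(2 : ℚ_[2])‖ = 2⁻¹ := Rank2Observatory.padic_norm_two
  have hm : Odd m := by
    have hδc : (x.den : ℚ_[2]) = 4 * (m : ℚ_[2]) := by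
      rw [show ((x.den : ℕ) : ℚ_[2]) = ((x.den : ℤ) : ℚ_[2]) by norm_cast, hDm]; push_cast; ring
    have h4n : ‖(4 : ℚ_[2])‖ = 4⁻¹ := by
      rw [show (4 : ℚ_[2]) = 2 * 2 by norm_num, norm_mul, h2n]; norm_num
    have hδ1 : ‖(m : ℚ_[2])‖ = 1 := by
      have := hndX; rw [hδc, norm_mul, h4n] at this
      linarith
    rw [← Int.not_even_iff_odd, even_iff_two_dvd]
    intro h2
    have := Padic.norm_intCast_lt_one_iff.mpr (by exact_mod_cast h2 : (2 : ℤ) ∣ m)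
    rw [hδ1] at this; exact lt_irrefl _ this
  -- the integer congruence modulo `2¹¹`
  obtain ⟨s, hs⟩ := neronNumerator_iterate_two_congr_two_pow_eleven A₂ A₃ A₄ A₆ x.num (x.den : ℤ) x₂.num (x₂.den : ℤ)
    x₄.num u m hau hm hDm ha' hD' ha''
  have hs' : x₄.num = 1 + 64 * u - 128 * u ^ 2 + 384 * A₄ - 1024 * A₄ * u - 128 * A₄ * (m ^ 2 - 1)
      - 512 * A₃ ^ 2 * m - 1024 * A₂ * A₃ + 2048 * s := by
    linear_combination hs
  -- Tate with two doublings: `‖⟨Q,Q⟩ − 16⁻¹ log₂ num x(4Q)‖ ≤ 2⁻⁷`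
  have hT : ‖D.pairing (.some x y h) (.some x y h) - ((4 : ℚ_[2]) ^ 2)⁻¹ * padicLog 2 (x₄.num : ℚ_[2])‖ ≤ 128⁻¹ :=
    (norm_pairing_sub_inv_mul_padicLog_num_le_rate V ha1 Sq h0 h1 h2 h3 hODE D hD h hx4 hns 2 (by norm_num) h₄ e₄).trans
      (by rw [hx]; norm_num)
  -- the logarithm of `num x(4Q) = 1 + t`, `‖t‖ ≤ 2⁻⁶`
  set t : ℚ_[2] := (x₄.num : ℚ_[2]) - 1 with ht
  have htc : t = 64 * ((u - 2 * u ^ 2 + 6 * A₄ - 16 * A₄ * u - 2 * A₄ * (m ^ 2 - 1) - 8 * A₃ ^ 2 * m - 16 * A₂ * A₃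
      + 32 * s : ℤ) : ℚ_[2]) := by
    have := congrArg (Int.cast : ℤ → ℚ_[2]) hs'
    push_cast at this
    rw [ht, this]; push_cast; ring
  have h64 : ‖(64 : ℚ_[2])‖ = 64⁻¹ := by
    rw [show (64 : ℚ_[2]) = 2 ^ 6 by norm_num, norm_pow, h2n]; norm_num
  have hnt : ‖t‖ ≤ 64⁻¹ := by
    rw [htc, norm_mul, h64]
    calc (64⁻¹ : ℝ) * ‖((u - 2 * u ^ 2 + 6 * A₄ - 16 * A₄ * u - 2 * A₄ * (m ^ 2 - 1) - 8 * A₃ ^ 2 * m - 16 * A₂ * A₃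
          + 32 * s : ℤ) : ℚ_[2])‖ ≤ 64⁻¹ * 1 := by
          gcongr; exact Padic.norm_int_le_one _
      _ = 64⁻¹ := by norm_num
  have hlog : ‖padicLog 2 (x₄.num : ℚ_[2]) - t‖ ≤ 2048⁻¹ := by
    have e : (x₄.num : ℚ_[2]) = 1 + t := by rw [ht]; ring
    have h3' := norm_padicLog_one_add_sub_add_le (t := t) (hnt.trans (by norm_num))
    rw [e, show padicLog 2 (1 + t) - t = (padicLog 2 (1 + t) - t + t ^ 2 / 2) + -(t ^ 2 / 2) by ring]
    refine (IsUltrametricDist.norm_add_le_max _ _).trans (max_le ?_ ?_)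
    · calc ‖padicLog 2 (1 + t) - t + t ^ 2 / 2‖ ≤ ‖t‖ ^ 3 := h3'
        _ ≤ (64⁻¹ : ℝ) ^ 3 := by gcongr
        _ ≤ 2048⁻¹ := by norm_num
    · rw [norm_neg, norm_div, norm_pow, h2n]
      calc ‖t‖ ^ 2 / (2⁻¹ : ℝ) = 2 * ‖t‖ ^ 2 := by ring
        _ ≤ 2 * (64⁻¹ : ℝ) ^ 2 := by gcongr
        _ = 2048⁻¹ := by norm_num
  -- assemble
  have hA2c : (V.a₂ : ℚ_[2]) = (A₂ : ℚ_[2]) := by rw [hA2, Rat.cast_intCast]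
  have hA3c : (V.a₃ : ℚ_[2]) = (A₃ : ℚ_[2]) := by rw [hA3, Rat.cast_intCast]
  have hA4c : (V.a₄ : ℚ_[2]) = (A₄ : ℚ_[2]) := by rw [hA4, Rat.cast_intCast]
  have hxn : (x.num : ℚ_[2]) - 1 = 4 * (u : ℚ_[2]) := by
    have := congrArg (Int.cast : ℤ → ℚ_[2]) hu
    push_cast at this
    exact this
  have hxd : (x.den : ℚ_[2]) = 4 * (m : ℚ_[2]) := by
    rw [show ((x.den : ℕ) : ℚ_[2]) = ((x.den : ℤ) : ℚ_[2]) by norm_cast, hDm]; push_cast; ring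
  have key : D.pairing (.some x y h) (.some x y h) - (((x.num : ℚ_[2]) - 1) - ((x.num : ℚ_[2]) - 1) ^ 2 / 2
        - 16 * (V.a₄ : ℚ_[2]) * ((x.num : ℚ_[2]) - 1) + 32 * (V.a₄ : ℚ_[2]) - (V.a₄ : ℚ_[2]) * (x.den : ℚ_[2]) ^ 2 / 2
        - 8 * (V.a₃ : ℚ_[2]) ^ 2 * (x.den : ℚ_[2]) - 64 * (V.a₂ : ℚ_[2]) * (V.a₃ : ℚ_[2])) =
      (D.pairing (.some x y h) (.some x y h) - ((4 : ℚ_[2]) ^ 2)⁻¹ * padicLog 2 (x₄.num : ℚ_[2]))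
        + ((4 : ℚ_[2]) ^ 2)⁻¹ * (padicLog 2 (x₄.num : ℚ_[2]) - t) + 128 * (s : ℚ_[2]) := by
    rw [hA2c, hA3c, hA4c, hxn, hxd, htc]; push_cast; ring
  have h16 : ‖((4 : ℚ_[2]) ^ 2)⁻¹‖ = 16 := by
    rw [norm_inv, norm_pow, show (4 : ℚ_[2]) = 2 ^ 2 by norm_num, norm_pow, h2n]; norm_num
  have h128 : ‖(128 : ℚ_[2])‖ = 128⁻¹ := by
    rw [show (128 : ℚ_[2]) = 2 ^ 7 by norm_num, norm_pow, h2n]; norm_num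
  rw [key]
  refine (IsUltrametricDist.norm_add_le_max _ _).trans (max_le ?_ ?_)
  · refine (IsUltrametricDist.norm_add_le_max _ _).trans (max_le hT ?_)
    rw [norm_mul, h16]
    calc (16 : ℝ) * ‖padicLog 2 (x₄.num : ℚ_[2]) - t‖ ≤ 16 * 2048⁻¹ := by gcongr
      _ = 128⁻¹ := by norm_num
  · rw [norm_mul, h128]
    calc (128⁻¹ : ℝ) * ‖(s : ℚ_[2])‖ ≤ 128⁻¹ * 1 := by gcongr; exact Padic.norm_int_le_one _
      _ = 128⁻¹ := by norm_num

/-- **`Sq`-free packaging**: over an elliptic `ℤ`-integral `V/ℚ` with `a₁ = 0`, the `η`-datum of `exists_etaHeightData_two` obeys the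
level-one law modulo `128`. [cite: SilvermanAEC2009, III.2.3(d), VIII.9] [cite: MazurSteinTate2006, §1] -/
theorem exists_heightData_levelOne_law_mod_oneTwentyEight_two (V : WeierstrassCurve ℚ) [V.IsElliptic] [V.IsIntegral ℤ]
    (ha1 : V.a₁ = 0) :
    ∃ D : PAdicHeightData V 2, ∀ {x y : ℚ} (h : V.toAffine.Nonsingular x y), ‖(x : ℚ_[2])‖ = 4 →
      (∀ ℓ : ℕ, ℓ.Prime → V.HasNonsingularReductionAt ℓ x y) →
      ‖D.pairing (.some x y h) (.some x y h) - (((x.num : ℚ_[2]) - 1) - ((x.num : ℚ_[2]) - 1) ^ 2 / 2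
        - 16 * (V.a₄ : ℚ_[2]) * ((x.num : ℚ_[2]) - 1) + 32 * (V.a₄ : ℚ_[2]) - (V.a₄ : ℚ_[2]) * (x.den : ℚ_[2]) ^ 2 / 2
        - 8 * (V.a₃ : ℚ_[2]) ^ 2 * (x.den : ℚ_[2]) - 64 * (V.a₂ : ℚ_[2]) * (V.a₃ : ℚ_[2]))‖ ≤ 128⁻¹ := by
  obtain ⟨Sq, D, h0, h1, h2, h3, hODE, hD⟩ := exists_etaHeightData_two V ha1
  exact ⟨D, fun h hx hns => norm_pairing_sub_law_le_inv_oneTwentyEight V ha1 Sq h0 h1 h2 h3 hODE D hD h hx hns⟩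

end NaiveSigmaLogAtTwo

end Summit.BirchSwinnertonDyer.BirchSwinnertonDyer.Theorems
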